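import Summits.MatrixMultiplication.OmegaCensus.STPPSmallPatternT2K6OrderLaw
import Summits.MatrixMultiplication.OmegaCensus.STPPSmallPatternSquareProducts
import Summits.MatrixMultiplication.OmegaCensus.STPPSmallPatternLawBridge
import Summits.MatrixMultiplication.OmegaCensus.STPPPatternMonotonicity

/-!
# ω-census, `(1,2,2)¹¹ ⊆ ℤ/23 × ℤ/3 × ℤ/3` by a product (the one odd blank seed of the `k = 11` host law; kernel, no search)

HONEST FRAMING (pub-omega census; verbatim): lottery ticket; floor = certified bounds/negative ranges.
Census STRUCTURE bookkeeping of the STPP track (seat pub-omega-stpp-3, gen 26; STRUCTURE row B5, column `T2`, §2 C10 row 11; prereg P-098 addendum 1, route P),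
not progress on `ω`.

The seed type `[23, 3, 3]` (order `207`) of the `(1,2,2)¹¹` host law «order `≥ 204`» stayed blank in the kit search (GO #125, 150 s).  It hosts by a product with no
search at all: `ℤ/23 × ℤ/3` has order `69 ≥ 64`, so it hosts `(1,2,2)⁶` by the `k = 6` host law (`exists_isSTPP_122pow6_of_card_ge_64`, stpp-3 gen 25); times the
2-element tricolored sum-free set of `ℤ/3` (`exists_isTSF_two_zmod`) this gives `(1,2,2)¹²` in `(ℤ/23 × ℤ/3) × ℤ/3` (`exists_isSTPP_cards_mul_of_tsf`), reassociated to
`ℤ/23 × (ℤ/3 × ℤ/3)` and cut to eleven triples.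

References: H. Cohn, R. Kleinberg, B. Szegedy, C. Umans, FOCS 2005 (arXiv:math/0511460), Def. 5.1.
-/

open Literature.Computability.AlgebraicComplexity Finset

namespace Summit.MatrixMultiplication.OmegaCensus

/-- **`(1,2,2)¹² ⊆ ℤ/23 × ℤ/3 × ℤ/3`** (`(1,2,2)⁶ ⊆ ℤ/23 × ℤ/3` by the `k = 6` host law, times the 2-element TSF of `ℤ/3`). [cite: CohnKleinbergSzegedyUmans2005, Def. 5.1] -/
theorem exists_isSTPP_122pow12_seed_23_3_3 :
    ∃ A B C : Fin 12 → Finset (ZMod 23 × ZMod 3 × ZMod 3), IsSTPP A B C ∧ ∀ i, (A i).card = 1 ∧ (B i).card = 2 ∧ (C i).card = 2 := by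
  have h6 : ∃ A B C : Fin 6 → Finset (ZMod 23 × ZMod 3), IsSTPP A B C ∧ ∀ i, (A i).card = 1 ∧ (B i).card = 2 ∧ (C i).card = 2 :=
    exists_isSTPP_122pow6_of_card_ge_64 (by simp)
  obtain ⟨σ, τ, υ, hT⟩ := exists_isTSF_two_zmod 3 (by norm_num)
  have h12 := exists_isSTPP_cards_mul_of_tsf h6 hT
  exact exists_isSTPP_cards_of_injective (AddEquiv.prodAssoc (M := ZMod 23) (N := ZMod 3) (P := ZMod 3)).toAddMonoidHom
    (AddEquiv.prodAssoc (M := ZMod 23) (N := ZMod 3) (P := ZMod 3)).injective h12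

/-- **`(1,2,2)¹¹ ⊆ ℤ/23 × ℤ/3 × ℤ/3`** (the previous family cut to eleven triples). [cite: CohnKleinbergSzegedyUmans2005, Def. 5.1] -/
theorem exists_isSTPP_122pow11_seed_23_3_3 :
    ∃ A B C : Fin 11 → Finset (ZMod 23 × ZMod 3 × ZMod 3), IsSTPP A B C ∧ ∀ i, (A i).card = 1 ∧ (B i).card = 2 ∧ (C i).card = 2 :=
  exists_isSTPP_of_embedding (fun _ => 1) (fun _ => 2) (fun _ => 2) (fun _ => 1) (fun _ => 2) (fun _ => 2)
    (Fin.castLE (by norm_num)) (Fin.castLE_injective (by norm_num)) (fun _ => le_rfl) (fun _ => le_rfl) (fun _ => le_rfl)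
    exists_isSTPP_122pow12_seed_23_3_3

end Summit.MatrixMultiplication.OmegaCensus
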